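import Summits.QuantumAdvantage.QuantumAdvantage.Theorems.LinnikCubicClassGroupsDegreeOnePrimesEscapePerCharacterDeficitZeroSum
import Summits.QuantumAdvantage.QuantumAdvantage.Theorems.LinnikCubicClassGroupsDegreeOnePrimesEscapePerCharacterDeficitSmoothed
import Literature.NumberTheory.LFunctions.ClassGroupLFunctionLogDerivLeft
import HarnessLib

/-!
# The smoothed character sum is one-sidedly small: `Re Σ_n Λ_χ(n) g_x(log n) ≤ η x`

Topic `Summits/QuantumAdvantage/QuantumAdvantage/Theorems`, helper for the stub
`stub_perCharacterDeficit_of_density` (line `subgroup-orthogonality-escape`, crux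
`DegreeOnePrimesEscape`, stmt-QuantumAdvantage-11543).

Assembly of the two analytic bricks: the zero sum over the NON-REAL zeros of `L₀(·,χ)` from an
abstract log-free density bound plus the field-uniform zero-free region of the tree
(`zeroSum_nonreal_le`, `exists_zeroFree_classGroupLFunction₀`), and the explicit formula with the
REAL zeros dropped by sign (`re_coefFordK_tzTest_le`), together with the tree's bounds for the
secondary terms (`analyticOrderNatAt_classGroupLFunction₀_zero_le`, `norm_cgEFRemainder_tzTest_zero_le`).
Result (`re_coefFordK_tzTest_le_mul`): for every `η > 0` there are `ν ∈ (0, 1/64]` and `a₁` (depending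
on the degree `n`, the density constants and `η`) such that for every `K` of degree `n`, every
`χ ≠ 1` satisfying the density bound and every `x ≥ Q^{a₁}` (`Q = condQn K`):

  `Re Σ_n Λ_χ(n) g(log n) ≤ η x`,   `g = tzTest (log x) x^{−ν}`.
-/

noncomputable section

open Complex Real MeasureTheory Set Filter Topology
open scoped NumberField nonZeroDivisors
open Literature.NumberTheory.LFunctions Literature.NumberTheory.LFunctions.NumberField
  Literature.NumberTheory.LFunctions.EntireEF Literature.NumberTheory.LFunctions.TZWeight

namespace Summit.QuantumAdvantage.QuantumAdvantage.Theorems.DegreeOnePrimesEscape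

/-! ### Elementary facts -/

/-- `|d_K| ≤ Q = |d_K| n^n`. -/
theorem natAbs_discr_le_condQn (K : Type) [Field K] [NumberField K] :
    ((NumberField.discr K).natAbs : ℝ) ≤ ThornerZaman.condQn K := by
  rw [ThornerZaman.condQn, Nat.cast_natAbs, Int.cast_abs]
  have hn1 : (1 : ℝ) ≤ (Module.finrank ℚ K : ℝ) ^ Module.finrank ℚ K := by
    have : (1 : ℝ) ≤ Module.finrank ℚ K := by
      exact_mod_cast Module.finrank_pos (R := ℚ) (M := K)
    exact one_le_pow₀ this
  nlinarith [abs_nonneg ((NumberField.discr K : ℝ))]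

/-- `0 ≤ log|d_K| ≤ Q − 1`. -/
theorem log_natAbs_discr_mem (K : Type) [Field K] [NumberField K] :
    0 ≤ Real.log ((NumberField.discr K).natAbs : ℝ) ∧
      Real.log ((NumberField.discr K).natAbs : ℝ) ≤ ThornerZaman.condQn K - 1 := by
  have hd1 : (1 : ℝ) ≤ ((NumberField.discr K).natAbs : ℝ) := by
    have h1 : 1 ≤ (NumberField.discr K).natAbs :=
      Nat.one_le_iff_ne_zero.2 (Int.natAbs_ne_zero.2 (NumberField.discr_ne_zero K))
    exact_mod_cast h1
  have h1 := Real.log_le_sub_one_of_pos (by linarith : (0:ℝ) < ((NumberField.discr K).natAbs : ℝ))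
  have h2 := natAbs_discr_le_condQn K
  exact ⟨Real.log_nonneg hd1, by linarith⟩

/-- `exp(−y) ≤ t` once `−log t ≤ y` (`t > 0`). -/
theorem exp_neg_le_of_neg_log_le {y t : ℝ} (ht : 0 < t) (h : -Real.log t ≤ y) : Real.exp (-y) ≤ t :=
  calc Real.exp (-y) ≤ Real.exp (Real.log t) := Real.exp_le_exp.2 (by linarith)
    _ = t := Real.exp_log ht

/-- `t ≤ exp y` once `log t ≤ y` (`t > 0`). -/
theorem le_exp_of_log_le {y t : ℝ} (ht : 0 < t) (h : Real.log t ≤ y) : t ≤ Real.exp y :=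
  calc t = Real.exp (Real.log t) := (Real.exp_log ht).symm
    _ ≤ Real.exp y := Real.exp_le_exp.2 h

/-- `L ≤ 8 e^{L/8}`. -/
theorem le_eight_mul_exp_div (L : ℝ) : L ≤ 8 * Real.exp (L / 8) := by
  have := Real.add_one_le_exp (L / 8); linarith

/-! ### The zero-free region in `Q`-form -/

/-- The tree's field-uniform zero-free region, for NON-REAL zeros, with `log|d_K|` replaced by
`a log Q ≥ log|d_K|`: `β ≤ 1 − c/(a log Q + log(|γ| + 4))`. -/
theorem zfr_nonreal_condQn {n : ℕ} {c a : ℝ} (hc : 0 < c) (ha : 1 ≤ a)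
    (hzfr : ∀ (K : Type) [Field K] [NumberField K], Module.finrank ℚ K = n →
      ∀ χ : ClassGroup (𝓞 K) →* ℂˣ, χ ≠ 1 → ∀ ρ : ℂ, classGroupLFunction₀ K χ ρ = 0 →
        1 - c / (Real.log ((NumberField.discr K).natAbs : ℝ) + Real.log (|ρ.im| + 4)) < ρ.re →
          χ * χ = 1 ∧ ρ.im = 0)
    (K : Type) [Field K] [NumberField K] (hKn : Module.finrank ℚ K = n) (hK : 1 < Module.finrank ℚ K)
    {χ : ClassGroup (𝓞 K) →* ℂˣ} (hχ : χ ≠ 1) (ρ : ℂ) (h0 : classGroupLFunction₀ K χ ρ = 0)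
    (him : ρ.im ≠ 0) :
    ρ.re ≤ 1 - c / (a * Real.log (ThornerZaman.condQn K) + Real.log (|ρ.im| + 4)) := by
  have hQ12 : (12 : ℝ) ≤ ThornerZaman.condQn K := ThornerZaman.twelve_le_condQn (K := K) hK
  have hlog4 : 0 < Real.log (|ρ.im| + 4) := Real.log_pos (by linarith [abs_nonneg ρ.im])
  obtain ⟨hlogd, -⟩ := log_natAbs_discr_mem K
  have hd0 : (0 : ℝ) < ((NumberField.discr K).natAbs : ℝ) := by
    exact_mod_cast Nat.pos_of_ne_zero (Int.natAbs_ne_zero.2 (NumberField.discr_ne_zero K))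
  have hlogdQ : Real.log ((NumberField.discr K).natAbs : ℝ) ≤ a * Real.log (ThornerZaman.condQn K) := by
    have h1 := Real.log_le_log hd0 (natAbs_discr_le_condQn K)
    have h2 : 0 ≤ Real.log (ThornerZaman.condQn K) := Real.log_nonneg (by linarith)
    nlinarith
  have h1 : ρ.re ≤ 1 - c / (Real.log ((NumberField.discr K).natAbs : ℝ) + Real.log (|ρ.im| + 4)) := by
    by_contra hcon
    rw [not_le] at hcon
    exact him (hzfr K hKn χ hχ ρ h0 hcon).2
  have h2 : c / (a * Real.log (ThornerZaman.condQn K) + Real.log (|ρ.im| + 4)) ≤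
      c / (Real.log ((NumberField.discr K).natAbs : ℝ) + Real.log (|ρ.im| + 4)) :=
    div_le_div_of_nonneg_left hc.le (by linarith) (by linarith)
  linarith

/-! ### The four smallness estimates -/

/-- (i) The main zero-sum term: `A₀ (e^{−cL/(4a log Q)} + e^{−√(cL/4)}) ≤ η/4` once
`L > 0`, `L ≥ a₁ log Q`, `L ≥ 2a₁`, `a₁ ≥ 4aΛ/c`, `a₁ ≥ 2Λ²/c`, `e^{−Λ} ≤ η/(8A₀)`. -/
theorem zeroSum_main_small {c a A₀ η Λ L a₁ lQ : ℝ} (hc : 0 < c) (ha : 1 ≤ a) (hA₀ : 0 < A₀)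
    (hΛ0 : 0 ≤ Λ) (hlQ : 0 < lQ) (hL : 0 < L) (hLQ : a₁ * lQ ≤ L) (hL2a : 2 * a₁ ≤ L)
    (ha₁i : 4 * a * Λ / c ≤ a₁) (ha₁i' : 2 * Λ ^ 2 / c ≤ a₁) (heΛ : Real.exp (-Λ) ≤ η / (8 * A₀)) :
    A₀ * (Real.exp (-(c * L / (4 * a * lQ))) + Real.exp (-Real.sqrt (c * L / 4))) ≤ η / 4 := by
  have hE1 : Real.exp (-(c * L / (4 * a * lQ))) ≤ η / (8 * A₀) := by
    refine le_trans (Real.exp_le_exp.2 (neg_le_neg ?_)) heΛ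
    rw [le_div_iff₀ (by positivity)]
    have h1 : Λ * (4 * a) ≤ c * a₁ := by
      have := (div_le_iff₀ hc).1 ha₁i; linarith
    calc Λ * (4 * a * lQ) = Λ * (4 * a) * lQ := by ring
      _ ≤ c * a₁ * lQ := mul_le_mul_of_nonneg_right h1 hlQ.le
      _ = c * (a₁ * lQ) := by ring
      _ ≤ c * L := mul_le_mul_of_nonneg_left hLQ hc.le
  have hE2 : Real.exp (-Real.sqrt (c * L / 4)) ≤ η / (8 * A₀) := by
    refine le_trans (Real.exp_le_exp.2 (neg_le_neg ?_)) heΛ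
    rw [Real.le_sqrt hΛ0 (by positivity : (0:ℝ) ≤ c * L / 4), le_div_iff₀ (by norm_num)]
    have h1 : Λ ^ 2 * 2 ≤ c * a₁ := by
      have := (div_le_iff₀ hc).1 ha₁i'; linarith
    have h2 : c * (2 * a₁) ≤ c * L := mul_le_mul_of_nonneg_left hL2a hc.le
    nlinarith
  calc A₀ * (Real.exp (-(c * L / (4 * a * lQ))) + Real.exp (-Real.sqrt (c * L / 4)))
      ≤ A₀ * (η / (8 * A₀) + η / (8 * A₀)) := mul_le_mul_of_nonneg_left (add_le_add hE1 hE2) hA₀.le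
    _ = η / 4 := by field_simp; ring

/-- (iii) The trivial zero: `m₀ (L + ε) ≤ 1152 e^{L/4}` for `χ ≠ 1`, `K` of degree `n > 1`,
`Q ≤ e^{L/8}`, `0 ≤ ε ≤ 1 ≤ L` (`m₀ ≤ 8(log|d_K| + 6n + 2) ≤ 72 Q`, `L ≤ 8e^{L/8}`). -/
theorem trivialZero_term_le (K : Type) [Field K] [NumberField K] (hK : 1 < Module.finrank ℚ K)
    {χ : ClassGroup (𝓞 K) →* ℂˣ} (hχ : χ ≠ 1) {L ε : ℝ} (hL : 1 ≤ L) (hε0 : 0 ≤ ε) (hε1 : ε ≤ 1)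
    (hQexp : ThornerZaman.condQn K ≤ Real.exp (L / 8)) :
    (analyticOrderNatAt (classGroupLFunction₀ K χ) 0 : ℝ) * (L + ε) ≤ 1152 * Real.exp (L / 4) := by
  set Q := ThornerZaman.condQn K with hQ
  have hQ12 : (12 : ℝ) ≤ Q := ThornerZaman.twelve_le_condQn (K := K) hK
  have hm₀ := analyticOrderNatAt_classGroupLFunction₀_zero_le (K := K) hχ
  obtain ⟨-, hlogd⟩ := log_natAbs_discr_mem K
  have hnQ : (Module.finrank ℚ K : ℝ) ≤ Q := ThornerZaman.finrank_le_condQn (K := K)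
  have h1 : 8 * (Real.log ((NumberField.discr K).natAbs : ℝ) + 6 * Module.finrank ℚ K + 2) ≤ 72 * Q := by
    rw [← hQ] at hlogd; linarith
  have h2 : L + ε ≤ 2 * L := by linarith
  have h3 : (analyticOrderNatAt (classGroupLFunction₀ K χ) 0 : ℝ) * (L + ε) ≤ 72 * Q * (2 * L) :=
    mul_le_mul (hm₀.trans h1) h2 (by linarith) (by positivity)
  have hL8 := le_eight_mul_exp_div L
  have hee : Real.exp (L / 8) * Real.exp (L / 8) = Real.exp (L / 4) := by
    rw [← Real.exp_add]; ring_nf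
  have h4 : Q * L ≤ Real.exp (L / 8) * (8 * Real.exp (L / 8)) :=
    mul_le_mul hQexp hL8 (by linarith) (Real.exp_pos _).le
  nlinarith [Real.exp_pos (L / 8)]

/-- (iv) The left-line integral: with the constant `Al` of
`exists_norm_logDeriv_classGroupLFunction_left_le` and the smooth-transition bound `M`,
`‖J_χ(0)‖ ≤ 8 · leftLineConst · Al (n + 1) M` for `g = tzTest L ε`, `ε = e^{−νL}`, `0 < ν ≤ 1/64`,
`Q ≤ e^{L/8}`, `0 < ε < L/2`, `ε ≤ 1`. -/
theorem leftLine_term_le {Al : ℝ} (hAl0 : 0 < Al)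
    (hAl : ∀ (K : Type) [Field K] [NumberField K] (χ : ClassGroup (𝓞 K) →* ℂˣ) (t : ℝ),
      ‖logDeriv (classGroupLFunction K χ) (-1 / 2 + t * I)‖ ≤
        Al * (Module.finrank ℚ K + 1) * (Real.log ((NumberField.discr K).natAbs : ℝ) + Real.log (|t| + 4)))
    {M : ℝ} (hM : ∀ y : ℝ, |iteratedDeriv 1 Real.smoothTransition y| ≤ M ∧
      |iteratedDeriv 2 Real.smoothTransition y| ≤ M)
    (K : Type) [Field K] [NumberField K] (hK : 1 < Module.finrank ℚ K)
    {χ : ClassGroup (𝓞 K) →* ℂˣ} (hχ : χ ≠ 1) {L ε ν : ℝ} (hL : 0 < L) (hε : 0 < ε) (hεL : ε < L / 2)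
    (hε1 : ε ≤ 1) (hν64 : ν ≤ 1 / 64) (hεexp : ε = Real.exp (-(ν * L)))
    (hQexp : ThornerZaman.condQn K ≤ Real.exp (L / 8)) :
    ‖cgEFRemainder χ (tzTest L ε) 0‖ ≤ 8 * leftLineConst * Al * (Module.finrank ℚ K + 1) * M := by
  have hJ := norm_cgEFRemainder_tzTest_zero_le hAl0 hAl hχ hM hL hε hεL
  have hM0 : 0 ≤ M := le_trans (abs_nonneg _) (hM 0).1
  have hlC := leftLineConst_nonneg
  set Q := ThornerZaman.condQn K with hQ
  have hQ12 : (12 : ℝ) ≤ Q := ThornerZaman.twelve_le_condQn (K := K) hK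
  obtain ⟨hlogd0, hlogd⟩ := log_natAbs_discr_mem K
  have hlogd4 : Real.log ((NumberField.discr K).natAbs : ℝ) + Real.log 4 + 1 ≤ 2 * Q := by
    have hlog4 : Real.log 4 ≤ 2 := by
      have : Real.log 4 = 2 * Real.log 2 := by
        rw [show (4:ℝ) = 2 ^ 2 by norm_num, Real.log_pow]; norm_num
      rw [this]; have := Real.log_two_lt_d9; linarith
    rw [← hQ] at hlogd; linarith
  have hexp1 : Real.exp (-(L / 4) + ε / 2) ≤ 2 * Real.exp (-(L / 4)) := by
    rw [Real.exp_add, mul_comm]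
    refine mul_le_mul_of_nonneg_right ?_ (Real.exp_pos _).le
    have hsq : Real.exp (ε / 2) ^ 2 < 2 ^ 2 := by
      rw [← Real.exp_nat_mul]
      have h1 : Real.exp ((2 : ℕ) * (ε / 2)) ≤ Real.exp 1 := Real.exp_le_exp.2 (by push_cast; linarith)
      have := Real.exp_one_lt_d9; linarith
    exact (lt_of_pow_lt_pow_left₀ 2 (by norm_num) hsq).le
  have hexp2 : 2 * M / ε ≤ 2 * M * Real.exp (L / 64) := by
    rw [hεexp, div_eq_mul_inv, ← Real.exp_neg, neg_neg]
    refine mul_le_mul_of_nonneg_left (Real.exp_le_exp.2 ?_) (by positivity)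
    nlinarith
  have hlog40 : 0 ≤ Real.log 4 := Real.log_nonneg (by norm_num)
  have hprod : (Real.log ((NumberField.discr K).natAbs : ℝ) + Real.log 4 + 1) *
      (Real.exp (-(L / 4) + ε / 2) * (2 * M / ε)) ≤ 8 * M := by
    calc (Real.log ((NumberField.discr K).natAbs : ℝ) + Real.log 4 + 1) *
          (Real.exp (-(L / 4) + ε / 2) * (2 * M / ε))
        ≤ (2 * Q) * ((2 * Real.exp (-(L / 4))) * (2 * M * Real.exp (L / 64))) :=
          mul_le_mul hlogd4 (mul_le_mul hexp1 hexp2 (by positivity) (by positivity))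
            (by positivity) (by positivity)
      _ ≤ (2 * Real.exp (L / 8)) * ((2 * Real.exp (-(L / 4))) * (2 * M * Real.exp (L / 64))) :=
          mul_le_mul_of_nonneg_right (by linarith) (by positivity)
      _ = 8 * M * Real.exp (L / 8 + -(L / 4) + L / 64) := by
          rw [Real.exp_add, Real.exp_add]; ring
      _ ≤ 8 * M * 1 := by
          refine mul_le_mul_of_nonneg_left ?_ (by positivity)
          rw [Real.exp_le_one_iff]; nlinarith
      _ = 8 * M := mul_one _
  refine hJ.trans ?_
  rw [mul_assoc (leftLineConst * (Al * ((Module.finrank ℚ K : ℝ) + 1)))]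
  calc leftLineConst * (Al * ((Module.finrank ℚ K : ℝ) + 1)) *
        ((Real.log ((NumberField.discr K).natAbs : ℝ) + Real.log 4 + 1) *
          (Real.exp (-(L / 4) + ε / 2) * (2 * M / ε)))
      ≤ leftLineConst * (Al * ((Module.finrank ℚ K : ℝ) + 1)) * (8 * M) :=
        mul_le_mul_of_nonneg_left hprod (by positivity)
    _ = _ := by ring

/-! ### The smoothed character sum -/

set_option maxHeartbeats 800000 in
/-- **The smoothed character sum is one-sidedly small.** For `n > 1`, density constants
`b, D > 0`, `a ≥ 1` and every `η > 0` there are `ν ∈ (0, 1/64]`, `a₁ ≥ 1` such that for every number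
field `K` of degree `n`, every `χ ≠ 1` whose zeros obey the log-free density bound
`Σ_{|γ| ≤ T, β ≥ α} m ≤ D e^{b(a log Q + log(T+4))(1−α)}` (`T ≥ 1`, `α ≤ 1`; `Q = condQn K`) and
every `x ≥ Q^{a₁}`: `Re Σ_n Λ_χ(n) g(log n) ≤ η x` for `g = tzTest (log x) x^{−ν}`. The real zeros of
`L₀(·,χ)` are dropped by sign; the non-real ones obey the tree's field-uniform zero-free region. -/
theorem re_coefFordK_tzTest_le_mul (n : ℕ) (hn : 1 < n) {b D a : ℝ} (hb : 0 < b) (hD : 0 < D)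
    (ha : 1 ≤ a) {η : ℝ} (hη : 0 < η) :
    ∃ ν a₁ : ℝ, 0 < ν ∧ ν ≤ 1 / 64 ∧ 1 ≤ a₁ ∧
    ∀ (K : Type) [Field K] [NumberField K], Module.finrank ℚ K = n →
    ∀ χ : ClassGroup (𝓞 K) →* ℂˣ, χ ≠ 1 →
      (∀ T : ℝ, 1 ≤ T → ∀ u : Finset ℂ,
        (∀ ρ ∈ u, classGroupLFunction₀ K χ ρ = 0 ∧ 1 / 4 ≤ ρ.re ∧ ρ.re < 1 ∧ |ρ.im| ≤ T) →
        ∀ α : ℝ, α ≤ 1 →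
          ∑ ρ ∈ u with α ≤ ρ.re, (analyticOrderNatAt (classGroupLFunction₀ K χ) ρ : ℝ) ≤
            D * Real.exp (b * (a * Real.log (ThornerZaman.condQn K) + Real.log (T + 4))) ^ (1 - α)) →
      ∀ x : ℝ, ThornerZaman.condQn K ^ a₁ ≤ x →
        (coefFordK (cgCoef χ) (tzTest (Real.log x) (x ^ (-ν))) 0).re ≤ η * x := by
  obtain ⟨ν, a₀, A₀, hν0, hν64, ha₀1, hA₀, hZ⟩ := zeroSum_nonreal_le n hn hb hD ha
  obtain ⟨c, hc, hzfr⟩ := exists_zeroFree_classGroupLFunction₀ n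
  obtain ⟨Al, hAl0, hAl⟩ := exists_norm_logDeriv_classGroupLFunction_left_le
  obtain ⟨M, hM1, hM⟩ := TZWeight.exists_smoothTransition_deriv_bound
  have hlC := leftLineConst_nonneg
  -- thresholds
  set Λ : ℝ := max 1 (Real.log (8 * A₀ / η)) with hΛ
  have hΛ0 : 0 ≤ Λ := le_trans zero_le_one (le_max_left _ _)
  set Λ₂ : ℝ := max 1 (Real.log (4608 / η)) with hΛ₂
  set CJ : ℝ := 8 * leftLineConst * Al * ((n : ℝ) + 1) * M with hCJ
  have hM0 : 0 ≤ M := by linarith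
  have hCJ0 : 0 ≤ CJ := by positivity
  set Λ₃ : ℝ := max 1 (Real.log (4 * (CJ + 1) / η)) with hΛ₃
  set a₁ : ℝ := max (max (max a₀ 8) (max (4 * a * Λ / c) (2 * Λ ^ 2 / c)))
    (max (Λ / (2 * ν)) (max Λ₂ Λ₃)) with ha₁
  have ha₁a₀ : a₀ ≤ a₁ := le_trans (le_trans (le_max_left _ _) (le_max_left _ _)) (le_max_left _ _)
  have ha₁8 : (8 : ℝ) ≤ a₁ := le_trans (le_trans (le_max_right _ _) (le_max_left _ _)) (le_max_left _ _)
  have ha₁i : 4 * a * Λ / c ≤ a₁ := le_trans (le_trans (le_max_left _ _) (le_max_right _ _)) (le_max_left _ _)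
  have ha₁i' : 2 * Λ ^ 2 / c ≤ a₁ := le_trans (le_trans (le_max_right _ _) (le_max_right _ _)) (le_max_left _ _)
  have ha₁ii : Λ / (2 * ν) ≤ a₁ := le_trans (le_max_left _ _) (le_max_right _ _)
  have ha₁iii : Λ₂ ≤ a₁ := le_trans (le_trans (le_max_left _ _) (le_max_right _ _)) (le_max_right _ _)
  have ha₁iv : Λ₃ ≤ a₁ := le_trans (le_trans (le_max_right _ _) (le_max_right _ _)) (le_max_right _ _)
  have ha₁1 : (1 : ℝ) ≤ a₁ := by linarith
  refine ⟨ν, a₁, hν0, hν64, ha₁1, fun K _ _ hKn χ hχ hdens x hx ↦ ?_⟩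
  -- sizes
  have hK : 1 < Module.finrank ℚ K := by rw [hKn]; exact hn
  set Q : ℝ := ThornerZaman.condQn K with hQ
  have hQ12 : (12 : ℝ) ≤ Q := ThornerZaman.twelve_le_condQn (K := K) hK
  have hQ1 : (1 : ℝ) < Q := by linarith
  have hlog12 : (2 : ℝ) ≤ Real.log 12 := by
    rw [Real.le_log_iff_exp_le (by norm_num)]
    have := Real.exp_one_lt_d9
    have h : Real.exp 2 = Real.exp 1 * Real.exp 1 := by rw [← Real.exp_add]; norm_num
    rw [h]; nlinarith [Real.exp_pos (1:ℝ)]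
  have hlogQ : 2 ≤ Real.log Q := hlog12.trans (Real.log_le_log (by norm_num) hQ12)
  have hlogQ0 : 0 < Real.log Q := by linarith
  have hxa₀ : Q ^ a₀ ≤ x := le_trans (Real.rpow_le_rpow_of_exponent_le hQ1.le ha₁a₀) hx
  have hxQ : Q ≤ x := by
    have : Q ^ (1 : ℝ) ≤ Q ^ a₁ := Real.rpow_le_rpow_of_exponent_le hQ1.le ha₁1
    rw [Real.rpow_one] at this; linarith
  have hx1 : 1 < x := by linarith
  have hx0 : 0 < x := by linarith
  set L : ℝ := Real.log x with hL
  have hLQ : a₁ * Real.log Q ≤ L := by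
    have := Real.log_le_log (by positivity) hx
    rwa [Real.log_rpow (by linarith)] at this
  have hL2a : 2 * a₁ ≤ L := by nlinarith
  have hL0 : 0 < L := by linarith
  have hexpL : Real.exp L = x := by rw [hL, Real.exp_log hx0]
  have hQexp : Q ≤ Real.exp (L / 8) := by
    refine le_exp_of_log_le (by linarith) ?_
    rw [le_div_iff₀ (by norm_num)]; nlinarith
  -- `ε = x^{−ν}`
  set ε : ℝ := x ^ (-ν) with hε
  have hε0 : 0 < ε := Real.rpow_pos_of_pos hx0 _
  have hε1 : ε ≤ 1 := Real.rpow_le_one_of_one_le_of_nonpos hx1.le (by linarith)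
  have hεL : ε < L / 2 := by linarith
  have hεexp : ε = Real.exp (-(ν * L)) := by
    rw [hε, Real.rpow_def_of_pos hx0, ← hL]; ring_nf
  -- the zero sum over the non-real zeros and the explicit formula
  have hzfr' : ∀ ρ : ℂ, classGroupLFunction₀ K χ ρ = 0 → 0 < ρ.re → ρ.re < 1 → ρ.im ≠ 0 →
      ρ.re ≤ 1 - c / (a * Real.log Q + Real.log (|ρ.im| + 4)) :=
    fun ρ h0 _ _ him ↦ zfr_nonreal_condQn hc ha hzfr K hKn hK hχ ρ h0 him
  have hB := hZ c hc K hKn χ hχ hzfr' hdens x hxa₀ ε le_rfl hε1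
  have hmain := re_coefFordK_tzTest_le hχ hx1 hε0 hεL hB
  -- (i) + (ii): the zero sum
  have heΛ : Real.exp (-Λ) ≤ η / (8 * A₀) := by
    refine exp_neg_le_of_neg_log_le (by positivity) ?_
    rw [← Real.log_inv, inv_div]; exact le_max_right _ _
  have hi : A₀ * x * (Real.exp (-(c * Real.log x / (4 * a * Real.log Q))) +
      Real.exp (-Real.sqrt (c * Real.log x / 4))) ≤ η / 4 * x := by
    have h := zeroSum_main_small hc ha hA₀ hΛ0 hlogQ0 hL0 hLQ hL2a ha₁i ha₁i' heΛ
    rw [← hL]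
    have := mul_le_mul_of_nonneg_left h hx0.le
    calc A₀ * x * (Real.exp (-(c * L / (4 * a * Real.log Q))) + Real.exp (-Real.sqrt (c * L / 4)))
        = x * (A₀ * (Real.exp (-(c * L / (4 * a * Real.log Q))) + Real.exp (-Real.sqrt (c * L / 4)))) := by
          ring
      _ ≤ x * (η / 4) := this
      _ = η / 4 * x := by ring
  have hii : A₀ * x ^ (1 - ν) ≤ η / 8 * x := by
    have hxν : x ^ (1 - ν) = x * Real.exp (-(ν * L)) := by
      rw [← hεexp, hε, sub_eq_add_neg, Real.rpow_add hx0, Real.rpow_one]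
    have hνL : Λ ≤ ν * L := by
      have := (div_le_iff₀ (by positivity)).1 ha₁ii; nlinarith
    have h1 : Real.exp (-(ν * L)) ≤ η / (8 * A₀) := (Real.exp_le_exp.2 (neg_le_neg hνL)).trans heΛ
    rw [hxν]
    calc A₀ * (x * Real.exp (-(ν * L))) ≤ A₀ * (x * (η / (8 * A₀))) :=
          mul_le_mul_of_nonneg_left (mul_le_mul_of_nonneg_left h1 hx0.le) hA₀.le
      _ = η / 8 * x := by field_simp
  -- (iii): the trivial zero
  have hiii : (analyticOrderNatAt (classGroupLFunction₀ K χ) 0 : ℝ) * (L + ε) ≤ η / 4 * x := by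
    have h4 := trivialZero_term_le K hK hχ (by linarith) hε0.le hε1 hQexp
    have he : 4608 / η ≤ Real.exp (3 * L / 4) := by
      refine le_exp_of_log_le (by positivity) ?_
      have := le_max_right 1 (Real.log (4608 / η)); rw [← hΛ₂] at this; linarith
    have hsplit : x = Real.exp (L / 4) * Real.exp (3 * L / 4) := by
      rw [← Real.exp_add, ← hexpL]; ring_nf
    have h5 : 1152 * Real.exp (L / 4) ≤ η / 4 * x := by
      rw [hsplit]
      have := mul_le_mul_of_nonneg_left he (by positivity : (0:ℝ) ≤ η / 4 * Real.exp (L / 4))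
      have e1 : η / 4 * Real.exp (L / 4) * (4608 / η) = 1152 * Real.exp (L / 4) := by
        field_simp; ring
      rw [e1] at this
      linarith
    linarith
  -- (iv): the left-line integral
  have hiv : ‖cgEFRemainder χ (tzTest L ε) 0‖ ≤ η / 4 * x := by
    have hJ := leftLine_term_le hAl0 hAl hM K hK hχ hL0 hε0 hεL hε1 hν64 hεexp hQexp
    rw [hKn] at hJ
    have hJ' : ‖cgEFRemainder χ (tzTest L ε) 0‖ ≤ CJ := by rw [hCJ]; linarith
    have he : 4 * (CJ + 1) / η ≤ x := by
      rw [← hexpL]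
      refine le_exp_of_log_le (by positivity) ?_
      have := le_max_right 1 (Real.log (4 * (CJ + 1) / η)); rw [← hΛ₃] at this; linarith
    have := (div_le_iff₀ hη).1 he
    linarith
  have hx' : (η / 4 * x + η / 8 * x) + η / 4 * x + η / 4 * x ≤ η * x := by nlinarith
  exact hmain.trans (le_trans (by linarith) hx')

/-- Closed form of `re_coefFordK_tzTest_le_mul`: the registered sub-goal of the stub `stub_perCharacterDeficit_of_density`
proved by this file. -/
theorem perCharacterDeficit_smoothedBound : ∀ (n : ℕ) (hn : 1 < n) {b D a : ℝ} (hb : 0 < b) (hD : 0 < D)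
    (ha : 1 ≤ a) {η : ℝ} (hη : 0 < η),
    ∃ ν a₁ : ℝ, 0 < ν ∧ ν ≤ 1 / 64 ∧ 1 ≤ a₁ ∧
    ∀ (K : Type) [Field K] [NumberField K], Module.finrank ℚ K = n →
    ∀ χ : ClassGroup (𝓞 K) →* ℂˣ, χ ≠ 1 →
      (∀ T : ℝ, 1 ≤ T → ∀ u : Finset ℂ,
        (∀ ρ ∈ u, classGroupLFunction₀ K χ ρ = 0 ∧ 1 / 4 ≤ ρ.re ∧ ρ.re < 1 ∧ |ρ.im| ≤ T) →
        ∀ α : ℝ, α ≤ 1 →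
          ∑ ρ ∈ u with α ≤ ρ.re, (analyticOrderNatAt (classGroupLFunction₀ K χ) ρ : ℝ) ≤
            D * Real.exp (b * (a * Real.log (ThornerZaman.condQn K) + Real.log (T + 4))) ^ (1 - α)) →
      ∀ x : ℝ, ThornerZaman.condQn K ^ a₁ ≤ x →
        (coefFordK (cgCoef χ) (tzTest (Real.log x) (x ^ (-ν))) 0).re ≤ η * x :=
  @re_coefFordK_tzTest_le_mul

end Summit.QuantumAdvantage.QuantumAdvantage.Theorems.DegreeOnePrimesEscape

end
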